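import Summits.Ventures.Crystal3D.Theorems.StickyWulffConstantCoaxialWallLawEndUnique
import Summits.Ventures.Crystal3D.Theorems.StickyWulffConstantCoaxialWallLawEndCharge
import Summits.Ventures.Crystal3D.Theorems.StickyWulffConstantCoaxialWallLawKFoldTop
import HarnessLib

/-!
# Exact end accounting for the word automaton, X: reachable ends at a ball ≤ its deficiency (modulo the k-fold-top census)

HONEST FRAMING. Part of the venture `Summits/Ventures/Crystal3D` (cell `crystal3d-full`), helper for the crux
`CoaxialWallLaw` (stmt-Ventures-19481) of `route-Ventures-StickyWulffConstant`, REGISTERED line `WallLedgerF`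
(planner cf-p1 gen 16), open stub `stub_coaxialTwoSlabAdhesion` (general fillings).  Rung credit only; F-C1 not
moved.  The SHARP END MULTIPLICITY of the exact count (memo F-CONSTANT-g6 §3): in the abstract class setting of
`…WordCore` with word rigidity (`hrigid`) and glide non-return (`hnoglide`), given BY NAME the E1 rows C12-55
(`hcert`) and the A12 glide star (`hcertA`) and the census target `KFoldTopDeficit` (`…KFoldTop`, posited):

**Theorem (`card_reached_ends_add_deg_le`).**  For every ball `b`, every finite set `T` of REACHABLE ENDS at `b`
(certified states `(b, κ)`, not moving, images `f u` of moving states) satisfies `#T + deg b ≤ 12` — each end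
consumes its own missing contact.  Proof: `#T = 1` is `word_reachable_end_le_eleven` (`…EndCharge`); for `#T ≥ 2`
the arrival data `(F κ, u_κ)` of the states of `T` form a `KFoldTopDeficit` configuration: the predecessor
`b − d κ` reads exactly in the arrival frame (`twinReading_next`: a crossing reading of `(F κ, m)` is a reading of
`(F (next κ m), −m)`), the predecessors are pairwise distinct (`word_reached_pred_ne`) and the frames pairwise
non-co-axial (`word_reached_not_coaxial`, `…EndUnique`; `KissingGap δ`, `δ > 0`, `δ² > 16/3`).

WHAT THIS IS NOT: not the stub; `KFoldTopDeficit` is an INPUT (census target, not proved); the cell and twin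
assembly (constant `√6/4 ≥ ½`) follow; F-C1 not moved.
-/

noncomputable section

namespace Summit.Ventures.Crystal3D.Theorems

open Summit.Ventures.Crystal3D Finset
open Literature.MathematicalPhysics.StatisticalMechanics (fccStacking)
open scoped InnerProductSpace

variable {X : Finset (EuclideanSpace ℝ (Fin 3))}

/-- **A crossing twin reading of `(G, m)` is a twin reading of the mirrored frame `(R_m ∘ G, −m)`.** -/
theorem twinReading_mirror (hX : ∀ p ∈ X, ∀ q ∈ X, p ≠ q → 1 ≤ dist p q)
    (G G' : EuclideanSpace ℝ (Fin 3) ≃ₗᵢ[ℝ] EuclideanSpace ℝ (Fin 3)) {m : EuclideanSpace ℝ (Fin 3)} (hm : ‖m‖ = 1)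
    (hmenu : ∀ w ∈ fccSlots, ⟪G w, m⟫_ℝ = 0 ∨ ⟪G w, m⟫_ℝ = Real.sqrt (2 / 3) ∨ ⟪G w, m⟫_ℝ = -Real.sqrt (2 / 3))
    (hG' : ∀ x, G' x = G x - (2 * ⟪G x, m⟫_ℝ) • m) {p : EuclideanSpace ℝ (Fin 3)}
    (hown : ∀ w ∈ fccSlots, ⟪G w, m⟫_ℝ ≤ 0 → p + G w ∈ X)
    (hmir : ∀ w ∈ fccSlots, ⟪G w, m⟫_ℝ < 0 → p + (G w - (2 * ⟪G w, m⟫_ℝ) • m) ∈ X) :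
    ‖-m‖ = 1 ∧
      (∀ w ∈ fccSlots, ⟪G' w, -m⟫_ℝ = 0 ∨ ⟪G' w, -m⟫_ℝ = Real.sqrt (2 / 3) ∨ ⟪G' w, -m⟫_ℝ = -Real.sqrt (2 / 3)) ∧
      (∀ w ∈ fccSlots, ⟪G' w, -m⟫_ℝ ≤ 0 → p + G' w ∈ X) ∧
      (∀ w ∈ fccSlots, ⟪G' w, -m⟫_ℝ < 0 → p + (G' w - (2 * ⟪G' w, -m⟫_ℝ) • (-m)) ∈ X) ∧
      (∀ w ∈ fccSlots, 0 < ⟪G' w, -m⟫_ℝ → p + G' w ∉ X) := by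
  have mm : ⟪m, m⟫_ℝ = 1 := by rw [real_inner_self_eq_norm_sq, hm, one_pow]
  -- the menu value in the mirrored frame is the old one
  have hval : ∀ x, ⟪G' x, -m⟫_ℝ = ⟪G x, m⟫_ℝ := by
    intro x; rw [hG' x, inner_neg_right, inner_sub_left, real_inner_smul_left, mm]; ring
  refine ⟨by rw [norm_neg, hm], fun w hw => by rw [hval]; exact hmenu w hw, ?_, ?_, ?_⟩
  · intro w hw hle
    rw [hval] at hle
    rcases hle.lt_or_eq with hlt | h0
    · rw [hG' w]; exact hmir w hw hlt
    · rw [hG' w, h0, mul_zero, zero_smul, sub_zero]; exact hown w hw hle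
  · intro w hw hlt
    rw [hval] at hlt
    have e : p + (G' w - (2 * ⟪G' w, -m⟫_ℝ) • (-m)) = p + G w := by
      rw [hval, hG' w, smul_neg, sub_neg_eq_add, sub_add_cancel]
    rw [e]; exact hown w hw hlt.le
  · intro w hw hpos
    rw [hval] at hpos
    rw [hG' w]
    exact twinDozen_mirror_pos_notMem hX G hm hmenu hown hw hpos

section Word

variable {K : Type*} {F : K → (EuclideanSpace ℝ (Fin 3) ≃ₗᵢ[ℝ] EuclideanSpace ℝ (Fin 3))}
  {d : K → EuclideanSpace ℝ (Fin 3)} {next : K → EuclideanSpace ℝ (Fin 3) → K}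
  {W : Finset (EuclideanSpace ℝ (Fin 3) × K)}
  {f : EuclideanSpace ℝ (Fin 3) × K → EuclideanSpace ℝ (Fin 3) × K}

open scoped Classical in
/-- **Reachable ends at a ball number at most its deficiency** (modulo `KFoldTopDeficit`).  See the module
docstring. -/
theorem card_reached_ends_add_deg_le {δ : ℝ} (hg : KissingGap δ) (hδ0 : 0 < δ) (hδ : 16 / 3 < δ ^ 2)
    (hX : ∀ p ∈ X, ∀ q ∈ X, p ≠ q → 1 ≤ dist p q)
    {s₀ : EuclideanSpace ℝ (Fin 3)} (hs₀ : s₀ ∈ fccSlots)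
    (hcert : ExactOnly 0 (fccSlots.filter fun w => 0 < ⟪w, s₀⟫_ℝ))
    (hcertA : ∀ (A : EuclideanSpace ℝ (Fin 3) ≃ₗᵢ[ℝ] EuclideanSpace ℝ (Fin 3)) (n : EuclideanSpace ℝ (Fin 3)),
      ‖n‖ = 1 → (∀ w ∈ fccSlots, ⟪A w, n⟫_ℝ = 0 ∨ ⟪A w, n⟫_ℝ = Real.sqrt (2 / 3) ∨ ⟪A w, n⟫_ℝ = -Real.sqrt (2 / 3)) →
      ∀ u ∈ fccSlots, ⟪A u, n⟫_ℝ = 0 → ∀ b : EuclideanSpace ℝ (Fin 3),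
      ExactOnly b (insert (b - A u)
        (((fccSlots.filter fun s => ⟪s, u⟫_ℝ = -(1 / 2) ∧ ⟪A (u + s), n⟫_ℝ ≤ 0).image (fun s => b + A s)) ∪
          ((fccSlots.filter fun s => ⟪s, u⟫_ℝ = -(1 / 2) ∧ ⟪A (u + s), n⟫_ℝ < 0).image
            (fun s => b + (A s - (2 * ⟪A s, n⟫_ℝ) • n))))))
    (hK : KFoldTopDeficit)
    (hd : ∀ κ, ∃ u ∈ fccSlots, d κ = F κ u)
    (hdn : ∀ κ, ∃ m : EuclideanSpace ℝ (Fin 3), ‖m‖ = 1 ∧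
      (∀ w ∈ fccSlots, ⟪F κ w, m⟫_ℝ = 0 ∨ ⟪F κ w, m⟫_ℝ = Real.sqrt (2 / 3) ∨ ⟪F κ w, m⟫_ℝ = -Real.sqrt (2 / 3)) ∧
      ⟪d κ, m⟫_ℝ = Real.sqrt (2 / 3))
    (hmirror : ∀ κ (m : EuclideanSpace ℝ (Fin 3)), ‖m‖ = 1 →
      (∀ w ∈ fccSlots, ⟪F κ w, m⟫_ℝ = 0 ∨ ⟪F κ w, m⟫_ℝ = Real.sqrt (2 / 3) ∨ ⟪F κ w, m⟫_ℝ = -Real.sqrt (2 / 3)) →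
      ⟪d κ, m⟫_ℝ = Real.sqrt (2 / 3) → ∀ x, F (next κ m) x = F κ x - (2 * ⟪F κ x, m⟫_ℝ) • m)
    (hdnext : ∀ κ (m : EuclideanSpace ℝ (Fin 3)), ‖m‖ = 1 →
      (∀ w ∈ fccSlots, ⟪F κ w, m⟫_ℝ = 0 ∨ ⟪F κ w, m⟫_ℝ = Real.sqrt (2 / 3) ∨ ⟪F κ w, m⟫_ℝ = -Real.sqrt (2 / 3)) →
      ⟪d κ, m⟫_ℝ = Real.sqrt (2 / 3) → ⟪d (next κ m), m⟫_ℝ = Real.sqrt (2 / 3))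
    (hW : ∀ v, v ∈ W ↔ (v.1 ∈ X ∧
      (∃ a ∈ fccSlots, ∃ a' ∈ fccSlots, ∃ a'' ∈ fccSlots,
        ⟪a, a'⟫_ℝ = 1 / 2 ∧ ⟪a, a''⟫_ℝ = 1 / 2 ∧ ⟪a', a''⟫_ℝ = 1 / 2 ∧
        v.1 + F v.2 a ∈ X ∧ v.1 + F v.2 a' ∈ X ∧ v.1 + F v.2 a'' ∈ X) ∧
      v.1 - d v.2 ∈ X))
    (hf_full : ∀ v ∈ W, (∀ w ∈ fccSlots, v.1 + F v.2 w ∈ X) → f v = (v.1 + d v.2, v.2))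
    (hf_cross : ∀ v ∈ W, ∀ m : EuclideanSpace ℝ (Fin 3), ‖m‖ = 1 →
      (∀ w ∈ fccSlots, ⟪F v.2 w, m⟫_ℝ = 0 ∨ ⟪F v.2 w, m⟫_ℝ = Real.sqrt (2 / 3) ∨ ⟪F v.2 w, m⟫_ℝ = -Real.sqrt (2 / 3)) →
      (∀ w ∈ fccSlots, ⟪F v.2 w, m⟫_ℝ ≤ 0 → v.1 + F v.2 w ∈ X) →
      (∀ w ∈ fccSlots, ⟪F v.2 w, m⟫_ℝ < 0 → v.1 + (F v.2 w - (2 * ⟪F v.2 w, m⟫_ℝ) • m) ∈ X) →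
      (∀ w ∈ fccSlots, 0 < ⟪F v.2 w, m⟫_ℝ → v.1 + F v.2 w ∉ X) →
      ⟪d v.2, m⟫_ℝ = Real.sqrt (2 / 3) → f v = (v.1 + d (next v.2 m), next v.2 m))
    (hf_glide : ∀ v ∈ W, ∀ m : EuclideanSpace ℝ (Fin 3), ‖m‖ = 1 →
      (∀ w ∈ fccSlots, ⟪F v.2 w, m⟫_ℝ = 0 ∨ ⟪F v.2 w, m⟫_ℝ = Real.sqrt (2 / 3) ∨ ⟪F v.2 w, m⟫_ℝ = -Real.sqrt (2 / 3)) →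
      (∀ w ∈ fccSlots, ⟪F v.2 w, m⟫_ℝ ≤ 0 → v.1 + F v.2 w ∈ X) →
      (∀ w ∈ fccSlots, ⟪F v.2 w, m⟫_ℝ < 0 → v.1 + (F v.2 w - (2 * ⟪F v.2 w, m⟫_ℝ) • m) ∈ X) →
      (∀ w ∈ fccSlots, 0 < ⟪F v.2 w, m⟫_ℝ → v.1 + F v.2 w ∉ X) →
      ⟪d v.2, m⟫_ℝ = 0 → f v = (v.1 + d v.2, v.2))
    (hrigid : ∀ κ₁ κ₂ : K, (∃ a ∈ fccSlots, ∃ a' ∈ fccSlots, ∃ a'' ∈ fccSlots,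
        ⟪a, a'⟫_ℝ = 1 / 2 ∧ ⟪a, a''⟫_ℝ = 1 / 2 ∧ ⟪a', a''⟫_ℝ = 1 / 2 ∧
        (∃ w ∈ fccSlots, F κ₂ w = F κ₁ a) ∧ (∃ w ∈ fccSlots, F κ₂ w = F κ₁ a') ∧
        (∃ w ∈ fccSlots, F κ₂ w = F κ₁ a'')) → κ₁ = κ₂)
    (hnoglide : ∀ (κ κ' : K) (m : EuclideanSpace ℝ (Fin 3)), ‖m‖ = 1 →
      (∀ w ∈ fccSlots, ⟪F κ w, m⟫_ℝ = 0 ∨ ⟪F κ w, m⟫_ℝ = Real.sqrt (2 / 3) ∨ ⟪F κ w, m⟫_ℝ = -Real.sqrt (2 / 3)) →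
      ⟪d κ, m⟫_ℝ = 0 →
      (F κ' : EuclideanSpace ℝ (Fin 3) → EuclideanSpace ℝ (Fin 3)) '' ↑fccSlots ≠
        (fun x => F κ x - (2 * ⟪F κ x, m⟫_ℝ) • m) '' ↑fccSlots)
    {b : EuclideanSpace ℝ (Fin 3)} (hb : b ∈ X) (T : Finset (EuclideanSpace ℝ (Fin 3) × K))
    (hT : ∀ v ∈ T, v.1 = b ∧
      ¬ ((∀ w ∈ fccSlots, v.1 + F v.2 w ∈ X) ∨
        ∃ m : EuclideanSpace ℝ (Fin 3), ‖m‖ = 1 ∧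
          (∀ w ∈ fccSlots, ⟪F v.2 w, m⟫_ℝ = 0 ∨ ⟪F v.2 w, m⟫_ℝ = Real.sqrt (2 / 3) ∨ ⟪F v.2 w, m⟫_ℝ = -Real.sqrt (2 / 3)) ∧
          (∀ w ∈ fccSlots, ⟪F v.2 w, m⟫_ℝ ≤ 0 → v.1 + F v.2 w ∈ X) ∧
          (∀ w ∈ fccSlots, ⟪F v.2 w, m⟫_ℝ < 0 → v.1 + (F v.2 w - (2 * ⟪F v.2 w, m⟫_ℝ) • m) ∈ X) ∧
          (∀ w ∈ fccSlots, 0 < ⟪F v.2 w, m⟫_ℝ → v.1 + F v.2 w ∉ X) ∧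
          (⟪d v.2, m⟫_ℝ = Real.sqrt (2 / 3) ∨ ⟪d v.2, m⟫_ℝ = 0)) ∧
      ∃ u ∈ W, ((∀ w ∈ fccSlots, u.1 + F u.2 w ∈ X) ∨
        ∃ m : EuclideanSpace ℝ (Fin 3), ‖m‖ = 1 ∧
          (∀ w ∈ fccSlots, ⟪F u.2 w, m⟫_ℝ = 0 ∨ ⟪F u.2 w, m⟫_ℝ = Real.sqrt (2 / 3) ∨ ⟪F u.2 w, m⟫_ℝ = -Real.sqrt (2 / 3)) ∧
          (∀ w ∈ fccSlots, ⟪F u.2 w, m⟫_ℝ ≤ 0 → u.1 + F u.2 w ∈ X) ∧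
          (∀ w ∈ fccSlots, ⟪F u.2 w, m⟫_ℝ < 0 → u.1 + (F u.2 w - (2 * ⟪F u.2 w, m⟫_ℝ) • m) ∈ X) ∧
          (∀ w ∈ fccSlots, 0 < ⟪F u.2 w, m⟫_ℝ → u.1 + F u.2 w ∉ X) ∧
          (⟪d u.2, m⟫_ℝ = Real.sqrt (2 / 3) ∨ ⟪d u.2, m⟫_ℝ = 0)) ∧ f u = v) :
    T.card + (X.filter fun q => dist b q = 1).card ≤ 12 := by
  have hdeg12 : (X.filter fun q => dist b q = 1).card ≤ 12 := card_filter_dist_eq_one_le_twelve X hX b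
  -- the arrival slot of a class
  have hσ : ∀ κ, ∃ u, u ∈ fccSlots ∧ d κ = F κ u := fun κ => by
    obtain ⟨u, hu, h⟩ := hd κ; exact ⟨u, hu, h⟩
  choose σ hσmem hσd using hσ
  -- every element of `T` is certified, at `b`, not moving, and reached
  rcases Nat.lt_or_ge T.card 2 with hlt | h2
  · -- `#T ≤ 1`
    rcases Nat.lt_or_ge T.card 1 with h0 | h1
    · omega
    · obtain ⟨v, hvT⟩ : T.Nonempty := by rw [← Finset.card_pos]; omega
      obtain ⟨hvb, hnm, u, huW, hum, hfu⟩ := hT v hvT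
      have h11 := word_reachable_end_le_eleven hX hs₀ hcert hcertA hd hdn hmirror hdnext hW hf_full hf_cross hf_glide
        huW hum (by rw [hfu]; exact hnm)
      rw [hfu, hvb] at h11
      omega
  · -- `#T ≥ 2`: the arrival data form a `KFoldTopDeficit` configuration
    set φ : EuclideanSpace ℝ (Fin 3) × K →
        (EuclideanSpace ℝ (Fin 3) ≃ₗᵢ[ℝ] EuclideanSpace ℝ (Fin 3)) × EuclideanSpace ℝ (Fin 3) :=
      fun v => (F v.2, σ v.2) with hφ
    set S := T.image φ with hS
    -- facts about two distinct members of `T`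
    have hpair : ∀ v ∈ T, ∀ v' ∈ T, v ≠ v' →
        v.1 - d v.2 ≠ v'.1 - d v'.2 ∧
        (F v'.2 : EuclideanSpace ℝ (Fin 3) → EuclideanSpace ℝ (Fin 3)) '' ↑fccSlots ≠
          (F v.2 : EuclideanSpace ℝ (Fin 3) → EuclideanSpace ℝ (Fin 3)) '' ↑fccSlots ∧
        ∀ n : EuclideanSpace ℝ (Fin 3), ‖n‖ = 1 →
          (∀ w ∈ fccSlots, ⟪F v.2 w, n⟫_ℝ = 0 ∨ ⟪F v.2 w, n⟫_ℝ = Real.sqrt (2 / 3) ∨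
            ⟪F v.2 w, n⟫_ℝ = -Real.sqrt (2 / 3)) →
          (F v'.2 : EuclideanSpace ℝ (Fin 3) → EuclideanSpace ℝ (Fin 3)) '' ↑fccSlots ≠
            (fun x => F v.2 x - (2 * ⟪F v.2 x, n⟫_ℝ) • n) '' ↑fccSlots := by
      intro v hv v' hv' hne
      obtain ⟨hvb, -, u, huW, hum, hfu⟩ := hT v hv
      obtain ⟨hv'b, -, u', hu'W, hum', hfu'⟩ := hT v' hv'
      have hv'W : v' ∈ W := by
        rw [← hfu']
        exact (word_move_target hd hdn hmirror hdnext hW hf_full hf_cross hf_glide hu'W hum').1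
      refine ⟨?_, ?_⟩
      · have := word_reached_pred_ne hX hd hdn hmirror hdnext hW hf_full hf_cross hf_glide hrigid hnoglide huW hu'W hum
          hum' (by rw [hfu, hfu']; exact hne)
        rw [hfu, hfu'] at this; exact this
      · have := word_reached_not_coaxial hg hδ0 hδ hX hd hdn hmirror hdnext hW hf_full hf_cross hf_glide hrigid hnoglide
          huW hum hv'W (by rw [hfu, hv'b, hvb]) (by rw [hfu]; exact hne.symm)
        rw [hfu] at this; exact this
    -- `φ` is injective on `T`
    have hinj : Set.InjOn φ ↑T := by
      intro v hv v' hv' hφe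
      by_contra hne
      have hF : F v.2 = F v'.2 := (Prod.mk.inj hφe).1
      exact (hpair v hv v' hv' hne).2.1 (by rw [hF])
    have hScard : S.card = T.card := card_image_of_injOn hinj
    -- members of `S`
    have hmemS : ∀ s ∈ S, ∃ v ∈ T, s = (F v.2, σ v.2) := by
      intro s hs
      obtain ⟨v, hv, rfl⟩ := mem_image.1 hs
      exact ⟨v, hv, rfl⟩
    have key := hK X hX b hb S (by rw [hScard]; exact h2) ?_ ?_ ?_ ?_
    · rw [hScard] at key; omega
    · -- slots and predecessors
      intro s hs
      obtain ⟨v, hv, rfl⟩ := hmemS s hs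
      obtain ⟨hvb, -, u, huW, hum, hfu⟩ := hT v hv
      have hvW : v ∈ W := by
        rw [← hfu]; exact (word_move_target hd hdn hmirror hdnext hW hf_full hf_cross hf_glide huW hum).1
      refine ⟨hσmem v.2, ?_⟩
      show b - F v.2 (σ v.2) ∈ X
      rw [← hσd, ← hvb]; exact ((hW v).1 hvW).2.2
    · -- the predecessor reads exactly in the arrival frame
      intro s hs
      obtain ⟨v, hv, rfl⟩ := hmemS s hs
      obtain ⟨hvb, -, u, huW, hum, hfu⟩ := hT v hv
      obtain ⟨-, hback, -⟩ := word_move_target hd hdn hmirror hdnext hW hf_full hf_cross hf_glide huW hum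
      have hp : b - F v.2 (σ v.2) = u.1 := by rw [← hσd, ← hvb, ← hfu]; exact hback
      simp only
      rw [hp]
      rcases hum with hfull | ⟨m, hm, hmenu, hown, hmir, hfar, hdm⟩
      · left
        have hκ : v.2 = u.2 := by rw [← hfu, hf_full u huW hfull]
        rw [hκ]; exact hfull
      · right
        rcases hdm with hdm | hdm
        · -- cross: a reading of the mirrored frame `(F (next κ m), −m)`
          have hκ : v.2 = next u.2 m := by rw [← hfu, hf_cross u huW m hm hmenu hown hmir hfar hdm]
          have hF' := hmirror u.2 m hm hmenu hdm
          obtain ⟨h1, h2, h3, h4, h5⟩ := twinReading_mirror hX (F u.2) (F (next u.2 m)) hm hmenu hF' hown hmir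
          rw [hκ]
          exact ⟨-m, h1, h2, h3, h4, h5⟩
        · -- glide: the same reading
          have hκ : v.2 = u.2 := by rw [← hfu, hf_glide u huW m hm hmenu hown hmir hfar hdm]
          rw [hκ]
          exact ⟨m, hm, hmenu, hown, hmir, hfar⟩
    · -- distinct predecessors
      intro s hs t ht hst
      obtain ⟨v, hv, rfl⟩ := hmemS s hs
      obtain ⟨v', hv', rfl⟩ := hmemS t ht
      have hne : v ≠ v' := fun h => hst (by rw [h])
      obtain ⟨hvb, -⟩ := hT v hv
      obtain ⟨hv'b, -⟩ := hT v' hv'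
      have h := (hpair v hv v' hv' hne).1
      simp only
      rw [← hσd, ← hσd, ← hvb]
      nth_rewrite 2 [hvb]; rw [← hv'b]
      exact h
    · -- non-co-axial frames
      intro s hs t ht hst
      obtain ⟨v, hv, rfl⟩ := hmemS s hs
      obtain ⟨v', hv', rfl⟩ := hmemS t ht
      have hne : v ≠ v' := fun h => hst (by rw [h])
      exact (hpair v hv v' hv' hne).2

end Word

end Summit.Ventures.Crystal3D.Theorems

end
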